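import Summits.Ventures.PercRepro2.CaseOneStarCertT1
import Summits.Ventures.PercRepro2.CaseOneGadgetUWA1BBlockIT0
import Summits.Ventures.PercRepro2.CaseOneGadgetUWA1BBlockIT1
import Summits.Ventures.PercRepro2.CaseOneGadgetUWA1BBlockIT2
import Summits.Ventures.PercRepro2.CaseOneGadgetUWA1BBlockIT3
import Summits.Ventures.PercRepro2.CaseOneGadgetUWA1BBlockIT4
import Summits.Ventures.PercRepro2.CaseOneGadgetUWA1BBlockIT5
import Summits.Ventures.PercRepro2.CaseOneGadgetUWA1BBlockIT6
import Summits.Ventures.PercRepro2.CaseOneGadgetUWA1BBlockIT7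
import Summits.Ventures.PercRepro2.CaseOneGadgetUWA1BBlockIT8
import Summits.Ventures.PercRepro2.CaseOneGadgetUWA1BBlockIT9
import Summits.Ventures.PercRepro2.CaseOneGadgetUWA1BBlockIT10
import Summits.Ventures.PercRepro2.CaseOneGadgetUWA1BBlockIT11
import Summits.Ventures.PercRepro2.CaseOneGadgetUWA1BBlockIT12
import Summits.Ventures.PercRepro2.CaseOneGadgetUWA1BBlockIT13

/-!
# The gadget `u ~ {w, a₁, b}`, `w ~ {u, a₂, o}` (uwa1b): the cell certificates of `iTAB5` (part 60a)
(blind cell PercRepro2, p1 g34; the fourth gadget anchor of the six-form calculus — all six forms of the uwa1b gadget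
as plain SFacts-cone certificate chains, generated by mining/p1/g34/uwa1b/genu.py = p1 g33's gent_uwa1.py / g25's
geno.py re-targeted; P1-G33 §6–§6″, P1-G34)

Each `eBABIT ijk kl` is a nonnegative combination of `(pairwise atom) × (cell)` and cubic cell monomials — or, for the degree-4 ones, `M × eBABIT ijk kl` (`M = Σ cᵢ` the total cell mass) is a nonnegative combination of `(atom) × (cell) × (cell)` and quartic cell monomials, then `SFacts.nonneg_of_sum_mul` (`CaseOneStarCertT1`) — exact LP certificates (kit j317114, every certificate re-verified exactly; data/p1/g33/gcerts_uwa1b.json, form `i-T`), here as exact `linear_combination`s over `SFacts` (the rational coefficients cleared by their common denominator). -/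

namespace Summit.Ventures.PercRepro2

namespace CaseOne

section CertABIT60a
variable {R : Type*} [Field R] [LinearOrder R] [IsStrictOrderedRing R]

set_option maxHeartbeats 0 in
/-- `eBABIT32221 ≥ 0`: the combination is identically zero (`ring`). -/
lemma eBABIT32221_nonneg (m : SCells R) (_hf : SFacts m) : 0 ≤ eBABIT32221 m := by
  have h : eBABIT32221 m = 0 := by
    unfold eBABIT32221 cBABIT00221 cBABIT01121 cBABIT01221 cBABIT02121 cBABIT02221 cBABIT10121 cBABIT10221 cBABIT11021 cBABIT11121 cBABIT11221 cBABIT12021 cBABIT12121 cBABIT12221 cBABIT20021 cBABIT20121 cBABIT20221 cBABIT21021 cBABIT21121 cBABIT21221 cBABIT22021 cBABIT22121 cBABIT22221 cBABIT30121 cBABIT30221 cBABIT31021 cBABIT31121 cBABIT31221 cBABIT32021 cBABIT32121 cBABIT32221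
    ring
  linarith [h]

set_option maxHeartbeats 0 in
/-- `eBABIT32222 ≥ 0`: the combination is identically zero (`ring`). -/
lemma eBABIT32222_nonneg (m : SCells R) (_hf : SFacts m) : 0 ≤ eBABIT32222 m := by
  have h : eBABIT32222 m = 0 := by
    unfold eBABIT32222 cBABIT00222 cBABIT01122 cBABIT01222 cBABIT02122 cBABIT02222 cBABIT10122 cBABIT10222 cBABIT11022 cBABIT11122 cBABIT11222 cBABIT12022 cBABIT12122 cBABIT12222 cBABIT20022 cBABIT20122 cBABIT20222 cBABIT21022 cBABIT21122 cBABIT21222 cBABIT22022 cBABIT22122 cBABIT22222 cBABIT30122 cBABIT30222 cBABIT31022 cBABIT31122 cBABIT31222 cBABIT32022 cBABIT32122 cBABIT32222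
    ring
  linarith [h]

end CertABIT60a

end CaseOne

end Summit.Ventures.PercRepro2
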